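import Summits.MatrixMultiplication.MatrixMultiplication.Theses.SnSubsetDichotomy
import Literature.Barriers.MatrixMultiplication.YoungSubgroupBarrier
import Literature.Barriers.MatrixMultiplication.QuasirandomBarrierSTPP
import Summits.MatrixMultiplication.MatrixMultiplication.Theorems.SnSubsetDichotomyGlobalBranchStubHostedPairCount
import Summits.MatrixMultiplication.MatrixMultiplication.Theorems.SnSubsetDichotomyGlobalBranchStubUrnBound
import Summits.MatrixMultiplication.MatrixMultiplication.Theorems.SnSubsetDichotomyGlobalBranchStubSqueezeInduction

/-!
# The Young double-coset squeeze (crux stmt-MatrixMultiplication-8303, line young-host-squeeze)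

Crux `Summit.MatrixMultiplication.MatrixMultiplication.Theses.SnSubsetDichotomy.GlobalBranch`.  The
class-pruning theorem of the line `young-host-squeeze`, assembled from its three landed stubs:

* `youngSqueeze_multinomial` — THE SQUEEZE: for two labellings `f g` of `Fin n` all of whose blocks
  have size `≤ n^θ`, `1/2 ≤ θ < 2/3`, and `n ≥ n₁(θ)`:
  `(∏_rows bᵢ!)(∏_cols cⱼ!) ≤ n!·e^{-n^{2-2θ}/32}·∏_cells e_q!`, i.e. every double coset `Y_f x Y_g`
  of two such Young subgroups is an `e^{-n^{2-2θ}/32}`-fraction of `𝔖ₙ` (row peeling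
  `stub_squeezeInduction` fed with the one-row urn bound `stub_urnBound`);
* `youngSqueeze_pair_subthreshold` — if `A, B` have the pairwise TPP, pack against a third set `W`
  (`|A||W|, |B||W| ≤ n!`) and are each CAPTURED to a fraction `> e^{-(κ/4)n^{2-2θ}}` by a coset of a
  fine Young subgroup, then `|A||B||W| ≤ (n!)^{3/2} e^{-(κ/4)√n}` (counted double-coset packing
  `stub_hostedPairCount` + the squeeze);
* `youngSqueeze_twoCaptured` — TWO CAPTURED SETS ARE SUB-THRESHOLD: for `1/2 ≤ θ < 2/3` there are
  `κ > 0`, `n₁` such that every TPP triple in `𝔖ₙ`, `n ≥ n₁`, in which some two of `S, T, U` are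
  captured to a fraction `> e^{-κ n^{2-2θ}}` by cosets `a·Y_f·b` of Young subgroups with blocks
  `≤ n^θ` has `|S||T||U| ≤ (n!)^{3/2} e^{-κ√n}`.  This kills the planar/hexagon Young witness
  family of `Negative/` (all sets hosted by Young subgroups with blocks `≍ √n`) with margin
  `e^{-Ω(n^{2-2θ})}` and reduces `GlobalBranch` to triples with at least two fine-Young-EVASIVE sets.
-/

set_option linter.dupNamespace false

open scoped BigOperators Classical
open Finset

namespace Summit.MatrixMultiplication.MatrixMultiplication.Theorems.GlobalBranch

open Literature.Combinatorics.Additive Literature.Barriers.MatrixMultiplication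

/-- **The multinomial squeeze** (fineness cap `1/2 ≤ θ < 2/3`, `κ = 1/32`): for two labellings
`f g` of `Fin n` all of whose blocks have size `≤ n^θ` and `n ≥ n₁(θ)`,
`∏_rows bᵢ! · ∏_cols cⱼ! ≤ n! · exp(-κ n^{2-2θ}) · ∏_cells e_q!`.  Row peeling
(`stub_squeezeInduction` on `s = univ`, `B = n^θ`, `m = n/2`, `κ₁ = n^{1-2θ}/16`) fed with the
one-row urn bound (`stub_urnBound`). [cite: BlasiakChurchCohnGrochowUmans2017, §4] -/
theorem youngSqueeze_multinomial : ∀ θ : ℝ, 1 / 2 ≤ θ → θ < 2 / 3 → ∃ κ : ℝ, 0 < κ ∧ ∃ n₁ : ℕ,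
    ∀ n ≥ n₁, ∀ f g : Fin n → ℕ,
    (∀ i, (((univ.filter (fun p => f p = i)).card : ℕ) : ℝ) ≤ (n : ℝ) ^ θ) →
    (∀ j, (((univ.filter (fun p => g p = j)).card : ℕ) : ℝ) ≤ (n : ℝ) ^ θ) →
    ((∏ i ∈ univ.image f, ((univ.filter (fun p => f p = i)).card).factorial : ℕ) : ℝ) *
        ((∏ j ∈ univ.image g, ((univ.filter (fun p => g p = j)).card).factorial : ℕ) : ℝ) ≤
      (n.factorial : ℝ) * Real.exp (-(κ * (n : ℝ) ^ (2 - 2 * θ))) *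
        ((∏ q ∈ univ.image (fun p => (f p, g p)),
            ((univ.filter (fun p => (f p, g p) = q)).card).factorial : ℕ) : ℝ) := by
  intro θ hθ hθ'
  obtain ⟨n₁, hurn⟩ := stub_urnBound θ hθ hθ'
  refine ⟨1 / 32, by norm_num, max n₁ 1, ?_⟩
  intro n hn f g hf hg
  have hn₁ : n₁ ≤ n := le_trans (le_max_left _ _) hn
  have hn1 : 1 ≤ n := le_trans (le_max_right _ _) hn
  have hnpos : (0 : ℝ) < (n : ℝ) := by exact_mod_cast hn1
  have hκ₁ : (0 : ℝ) ≤ (n : ℝ) ^ (1 - 2 * θ) / 16 := by positivity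
  have hind := stub_squeezeInduction n ((n : ℝ) ^ θ) ((n : ℝ) / 2) ((n : ℝ) ^ (1 - 2 * θ) / 16)
    (by positivity) hκ₁ (fun J c e N b h1 h2 h3 h4 h5 h6 => hurn n hn₁ J c e N b h1 h2 h3 h4 h5 h6)
    univ f g hf hg
  rw [Finset.card_univ, Fintype.card_fin] at hind
  have hexp : (n : ℝ) ^ (1 - 2 * θ) / 16 * ((n : ℝ) - (n : ℝ) / 2) =
      1 / 32 * (n : ℝ) ^ (2 - 2 * θ) := by
    have h2 : (n : ℝ) ^ (2 - 2 * θ) = (n : ℝ) ^ (1 - 2 * θ) * (n : ℝ) := by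
      rw [show (2 - 2 * θ) = (1 - 2 * θ) + 1 by ring, Real.rpow_add_one hnpos.ne']
    rw [h2]; ring
  rw [hexp] at hind
  set R : ℝ := ((∏ i ∈ univ.image f, ((univ.filter (fun p => f p = i)).card).factorial : ℕ) : ℝ)
  set C : ℝ := ((∏ j ∈ univ.image g, ((univ.filter (fun p => g p = j)).card).factorial : ℕ) : ℝ)
  set E : ℝ := ((∏ q ∈ univ.image (fun p => (f p, g p)),
            ((univ.filter (fun p => (f p, g p) = q)).card).factorial : ℕ) : ℝ)
  have hE : Real.exp (-(1 / 32 * (n : ℝ) ^ (2 - 2 * θ))) *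
      Real.exp (1 / 32 * (n : ℝ) ^ (2 - 2 * θ)) = 1 := by
    rw [← Real.exp_add]; simp
  calc R * C = R * C * Real.exp (1 / 32 * (n : ℝ) ^ (2 - 2 * θ)) *
        Real.exp (-(1 / 32 * (n : ℝ) ^ (2 - 2 * θ))) := by
          rw [mul_assoc (R * C), mul_comm (Real.exp _), hE, mul_one]
    _ ≤ (n.factorial : ℝ) * E * Real.exp (-(1 / 32 * (n : ℝ) ^ (2 - 2 * θ))) := by
          gcongr
    _ = (n.factorial : ℝ) * Real.exp (-(1 / 32 * (n : ℝ) ^ (2 - 2 * θ))) * E := by ring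

/-- Fineness (`all blocks ≤ n^θ`) is invariant under relabelling the points by a permutation.
[folklore] -/
theorem youngSqueeze_fine_comp {n : ℕ} {θ : ℝ} {g : Fin n → ℕ}
    (hg : ∀ j, (((univ.filter (fun p => g p = j)).card : ℕ) : ℝ) ≤ (n : ℝ) ^ θ)
    (y : Equiv.Perm (Fin n)) :
    ∀ j, (((univ.filter (fun p => g (y p) = j)).card : ℕ) : ℝ) ≤ (n : ℝ) ^ θ := by
  intro j
  have hc : (univ.filter (fun p => g (y p) = j)).card = (univ.filter (fun q => g q = j)).card := by
    refine Finset.card_equiv y ?_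
    intro p
    simp
  rw [hc]
  exact hg j

/-- Real bookkeeping: cancel the (positive) cell product. [folklore] -/
theorem youngSqueeze_core_cancel {x y P R C B : ℝ} (h1 : x * y * P ≤ R * C) (h2 : R * C ≤ B * P)
    (hP : 0 < P) : x * y ≤ B :=
  le_of_mul_le_mul_right (h1.trans h2) hP

/-- Real bookkeeping: two captures of strength `δ = e^{-(κ/4)m}` against `x·y ≤ F e^{-κ m}` give
`a·b ≤ F e^{-(κ/2) m}`. [folklore] -/
theorem youngSqueeze_core_capture {δ a b x y F κ m : ℝ} (hδ : δ = Real.exp (-(κ / 4 * m)))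
    (hA : δ * a < x) (hB : δ * b < y) (h3 : x * y ≤ F * Real.exp (-(κ * m)))
    (ha : 0 ≤ a) (hb : 0 ≤ b) (_hF : 0 ≤ F) :
    a * b ≤ F * Real.exp (-(κ / 2 * m)) := by
  have hδ0 : 0 < δ := by rw [hδ]; exact Real.exp_pos _
  have hE4 : Real.exp (-(κ * m)) = δ ^ 4 := by
    rw [hδ, ← Real.exp_nat_mul]; congr 1; push_cast; ring
  have hE2 : Real.exp (-(κ / 2 * m)) = δ ^ 2 := by
    rw [hδ, ← Real.exp_nat_mul]; congr 1; push_cast; ring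
  have hx : 0 ≤ x := le_of_lt (lt_of_le_of_lt (by positivity) hA)
  have hxy : δ * a * (δ * b) ≤ x * y := mul_le_mul hA.le hB.le (by positivity) hx
  have h5 : δ ^ 2 * (a * b) ≤ δ ^ 2 * (F * Real.exp (-(κ / 2 * m))) := by
    calc δ ^ 2 * (a * b) = δ * a * (δ * b) := by ring
      _ ≤ x * y := hxy
      _ ≤ F * Real.exp (-(κ * m)) := h3
      _ = δ ^ 2 * (F * Real.exp (-(κ / 2 * m))) := by rw [hE4, hE2]; ring
  exact le_of_mul_le_mul_left h5 (by positivity)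

/-- Real bookkeeping: from the squared volume bound to the `(n!)^{3/2}` form. [folklore] -/
theorem youngSqueeze_vol_le_of_sq {v F E₁ E₂ : ℝ} (hF : 0 < F) (hE₂ : 0 ≤ E₂)
    (hv : v ^ 2 ≤ F * E₁ * (F * F)) (hE : E₁ ≤ E₂ ^ 2) :
    v ≤ F ^ ((3 : ℝ) / 2) * E₂ := by
  have h3 : (F ^ ((3 : ℝ) / 2)) ^ 2 = F ^ 3 := by
    rw [← Real.rpow_mul_natCast hF.le, show ((3 : ℝ) / 2 * (2 : ℕ)) = ((3 : ℕ) : ℝ) by norm_num,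
      Real.rpow_natCast]
  have h4 : v ^ 2 ≤ (F ^ ((3 : ℝ) / 2) * E₂) ^ 2 := by
    calc v ^ 2 ≤ F * E₁ * (F * F) := hv
      _ = F ^ 3 * E₁ := by ring
      _ ≤ F ^ 3 * E₂ ^ 2 := by gcongr
      _ = (F ^ ((3 : ℝ) / 2) * E₂) ^ 2 := by rw [mul_pow, h3]
  exact le_of_pow_le_pow_left₀ two_ne_zero (by positivity) h4

/-- **The squeeze for a captured pair**: if `A, B ⊆ 𝔖ₙ` have the pairwise TPP, pack against a
third set `W` (`|A||W|, |B||W| ≤ n!`), the squeeze inequality holds at `(θ, κ)` for all fine pairs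
of labellings, and `A` (resp. `B`) is captured to a fraction `> e^{-(κ/4) n^{2-2θ}}` by the coset
`a·Y_f·b` (resp. `a'·Y_g·b'`) of a Young subgroup with blocks `≤ n^θ`, `θ < 3/4`, then
`|A||B||W| ≤ (n!)^{3/2} e^{-(κ/4)√n}`. [cite: BlasiakChurchCohnGrochowUmans2017, §4] -/
theorem youngSqueeze_pair_subthreshold {n : ℕ} {θ κ : ℝ} (hθ : θ < 3 / 4) (hκ : 0 < κ) (hn : 1 ≤ n)
    (hsq : ∀ f g : Fin n → ℕ,
      (∀ i, (((univ.filter (fun p => f p = i)).card : ℕ) : ℝ) ≤ (n : ℝ) ^ θ) →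
      (∀ j, (((univ.filter (fun p => g p = j)).card : ℕ) : ℝ) ≤ (n : ℝ) ^ θ) →
      ((∏ i ∈ univ.image f, ((univ.filter (fun p => f p = i)).card).factorial : ℕ) : ℝ) *
        ((∏ j ∈ univ.image g, ((univ.filter (fun p => g p = j)).card).factorial : ℕ) : ℝ) ≤
      (n.factorial : ℝ) * Real.exp (-(κ * (n : ℝ) ^ (2 - 2 * θ))) *
        ((∏ q ∈ univ.image (fun p => (f p, g p)),
            ((univ.filter (fun p => (f p, g p) = q)).card).factorial : ℕ) : ℝ))
    (A B W : Finset (Equiv.Perm (Fin n)))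
    (hAB : ∀ s ∈ A, ∀ s' ∈ A, ∀ t ∈ B, ∀ t' ∈ B, s * s'⁻¹ * (t * t'⁻¹) = 1 → s = s' ∧ t = t')
    (hAW : A.card * W.card ≤ n.factorial) (hBW : B.card * W.card ≤ n.factorial)
    (f : Fin n → ℕ) (hf : ∀ i, (((univ.filter (fun p => f p = i)).card : ℕ) : ℝ) ≤ (n : ℝ) ^ θ)
    (a b : Equiv.Perm (Fin n))
    (hA : Real.exp (-(κ / 4 * (n : ℝ) ^ (2 - 2 * θ))) * (A.card : ℝ) <
      (((A.filter (fun σ => a⁻¹ * σ * b⁻¹ ∈ youngSubgroup f)).card : ℕ) : ℝ))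
    (g : Fin n → ℕ) (hg : ∀ j, (((univ.filter (fun p => g p = j)).card : ℕ) : ℝ) ≤ (n : ℝ) ^ θ)
    (a' b' : Equiv.Perm (Fin n))
    (hB : Real.exp (-(κ / 4 * (n : ℝ) ^ (2 - 2 * θ))) * (B.card : ℝ) <
      (((B.filter (fun σ => a'⁻¹ * σ * b'⁻¹ ∈ youngSubgroup g)).card : ℕ) : ℝ)) :
    (A.card : ℝ) * B.card * W.card ≤
      (n.factorial : ℝ) ^ ((3 : ℝ) / 2) * Real.exp (-(κ / 4 * Real.sqrt (n : ℝ))) := by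
  have hF0 : (0 : ℝ) < (n.factorial : ℝ) := by exact_mod_cast n.factorial_pos
  -- the relabelled column labelling is fine
  have hg' := youngSqueeze_fine_comp hg (a'⁻¹ * a)
  -- counted double-coset packing (stub 1, cast to ℝ) and the squeeze at (f, g ∘ (a'⁻¹a))
  have h1 := stub_hostedPairCount A B f g a b a' b' hAB
  have h1r := (Nat.cast_le (α := ℝ)).mpr h1
  simp only [Nat.cast_mul] at h1r
  have h2 := hsq f (fun p => g ((a'⁻¹ * a) p)) hf hg'
  have h3 := youngSqueeze_core_cancel h1r h2 (by positivity)
  have h4 : (A.card : ℝ) * B.card ≤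
      (n.factorial : ℝ) * Real.exp (-(κ / 2 * (n : ℝ) ^ (2 - 2 * θ))) :=
    youngSqueeze_core_capture rfl hA hB h3 (by positivity) (by positivity) hF0.le
  have hAWr : (A.card : ℝ) * W.card ≤ (n.factorial : ℝ) := by exact_mod_cast hAW
  have hBWr : (B.card : ℝ) * W.card ≤ (n.factorial : ℝ) := by exact_mod_cast hBW
  have hv : ((A.card : ℝ) * B.card * W.card) ^ 2 ≤
      (n.factorial : ℝ) * Real.exp (-(κ / 2 * (n : ℝ) ^ (2 - 2 * θ))) *
        ((n.factorial : ℝ) * (n.factorial : ℝ)) := by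
    calc ((A.card : ℝ) * B.card * W.card) ^ 2
          = ((A.card : ℝ) * B.card) * (((A.card : ℝ) * W.card) * ((B.card : ℝ) * W.card)) := by
            ring
      _ ≤ (n.factorial : ℝ) * Real.exp (-(κ / 2 * (n : ℝ) ^ (2 - 2 * θ))) *
            ((n.factorial : ℝ) * (n.factorial : ℝ)) := by gcongr
  have hn1 : (1 : ℝ) ≤ (n : ℝ) := by exact_mod_cast hn
  have hsqrt_le : Real.sqrt (n : ℝ) ≤ (n : ℝ) ^ (2 - 2 * θ) := by
    rw [Real.sqrt_eq_rpow]
    exact Real.rpow_le_rpow_of_exponent_le hn1 (by linarith)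
  have hE : Real.exp (-(κ / 2 * (n : ℝ) ^ (2 - 2 * θ))) ≤
      (Real.exp (-(κ / 4 * Real.sqrt (n : ℝ)))) ^ 2 := by
    rw [← Real.exp_nat_mul, Real.exp_le_exp]
    push_cast
    nlinarith [mul_le_mul_of_nonneg_left hsqrt_le hκ.le]
  exact youngSqueeze_vol_le_of_sq hF0 (Real.exp_pos _).le hv hE

/-- From the TPP: the pairwise part for `(S,T)` (needs `U` non-empty). [cite: CohnUmans2003, Def. 2.1] -/
theorem youngSqueeze_pairTPP_of_tpp {n : ℕ} {S T U : Finset (Equiv.Perm (Fin n))}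
    (h : TripleProductProperty S T U) (hU : U.Nonempty) :
    ∀ s ∈ S, ∀ s' ∈ S, ∀ t ∈ T, ∀ t' ∈ T, s * s'⁻¹ * (t * t'⁻¹) = 1 → s = s' ∧ t = t' := by
  obtain ⟨u, hu⟩ := hU
  intro s hs s' hs' t ht t' ht' heq
  have key : s * s'⁻¹ * (t * t'⁻¹) * (u * u⁻¹) = 1 := by rw [mul_inv_cancel, mul_one, heq]
  obtain ⟨h1, h2, -⟩ := h s hs s' hs' t ht t' ht' u hu u hu key
  exact ⟨h1, h2⟩

/-- **Two captured sets are sub-threshold** (the class-pruning theorem of the line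
`young-host-squeeze`): for every fineness cap `1/2 ≤ θ < 2/3` there are `κ > 0` and `n₁` such that
every TPP triple `S, T, U ⊆ 𝔖ₙ`, `n ≥ n₁`, in which some two of the three sets (in distinct roles)
are each captured to a fraction `> e^{-κ n^{2-2θ}}` by a two-sided coset `a·Y_f·b` of a Young
subgroup all of whose blocks have size `≤ n^θ` satisfies `|S||T||U| ≤ (n!)^{3/2} e^{-κ√n}`.
(`κ = 1/128`.)  Consequently `GlobalBranch` reduces to bump-free triples with at least two
`(θ,κ)`-fine-Young-EVASIVE sets. [cite: BlasiakChurchCohnGrochowUmans2017, §4] -/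
theorem youngSqueeze_twoCaptured : ∀ θ : ℝ, 1 / 2 ≤ θ → θ < 2 / 3 → ∃ κ : ℝ, 0 < κ ∧ ∃ n₁ : ℕ,
    ∀ n ≥ n₁, ∀ S T U : Finset (Equiv.Perm (Fin n)), TripleProductProperty S T U →
    (∃ X₁ X₂ : Finset (Equiv.Perm (Fin n)),
      ((X₁ = S ∧ X₂ = T) ∨ (X₁ = T ∧ X₂ = U) ∨ (X₁ = S ∧ X₂ = U)) ∧
      (∃ f : Fin n → ℕ, (∀ i, (((univ.filter (fun p => f p = i)).card : ℕ) : ℝ) ≤ (n : ℝ) ^ θ) ∧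
        ∃ a b : Equiv.Perm (Fin n), Real.exp (-(κ * (n : ℝ) ^ (2 - 2 * θ))) * (X₁.card : ℝ) <
          (((X₁.filter (fun σ => a⁻¹ * σ * b⁻¹ ∈ youngSubgroup f)).card : ℕ) : ℝ)) ∧
      (∃ g : Fin n → ℕ, (∀ j, (((univ.filter (fun p => g p = j)).card : ℕ) : ℝ) ≤ (n : ℝ) ^ θ) ∧
        ∃ a' b' : Equiv.Perm (Fin n), Real.exp (-(κ * (n : ℝ) ^ (2 - 2 * θ))) * (X₂.card : ℝ) <
          (((X₂.filter (fun σ => a'⁻¹ * σ * b'⁻¹ ∈ youngSubgroup g)).card : ℕ) : ℝ))) →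
    ((S.card * T.card * U.card : ℕ) : ℝ) ≤
      (n.factorial : ℝ) ^ ((3 : ℝ) / 2) * Real.exp (-(κ * Real.sqrt (n : ℝ))) := by
  intro θ hθ hθ'
  obtain ⟨κ, hκ, n₁, hsq⟩ := youngSqueeze_multinomial θ hθ hθ'
  have hθ'' : θ < 3 / 4 := by linarith
  refine ⟨κ / 4, by positivity, max n₁ 1, ?_⟩
  intro n hn S T U htpp hcap
  have hn₁ : n₁ ≤ n := le_trans (le_max_left _ _) hn
  have hn1 : 1 ≤ n := le_trans (le_max_right _ _) hn
  obtain ⟨X₁, X₂, hroles, ⟨f, hf, a, b, hA⟩, ⟨g, hg, a', b', hB⟩⟩ := hcap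
  -- an empty set gives volume 0
  by_cases hS : S = ∅
  · subst hS; simp only [Finset.card_empty, zero_mul, Nat.cast_zero]; positivity
  by_cases hT : T = ∅
  · subst hT; simp only [Finset.card_empty, zero_mul, mul_zero, Nat.cast_zero]; positivity
  by_cases hU : U = ∅
  · subst hU; simp only [Finset.card_empty, mul_zero, Nat.cast_zero]; positivity
  have hSn : S.Nonempty := Finset.nonempty_iff_ne_empty.2 hS
  have hTn : T.Nonempty := Finset.nonempty_iff_ne_empty.2 hT
  have hUn : U.Nonempty := Finset.nonempty_iff_ne_empty.2 hU
  -- packing |S||T|, |T||U|, |U||S| ≤ n!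
  obtain ⟨hST, hTU, hUS⟩ := tpp_card_mul_card_le_three htpp hSn hTn hUn
  have hcard : Fintype.card (Equiv.Perm (Fin n)) = n.factorial := by
    rw [Fintype.card_perm, Fintype.card_fin]
  rw [hcard] at hST hTU hUS
  have hTS : T.card * S.card ≤ n.factorial := by simpa [mul_comm] using hST
  have hSU : S.card * U.card ≤ n.factorial := by simpa [mul_comm] using hUS
  have hUT : U.card * T.card ≤ n.factorial := by simpa [mul_comm] using hTU
  have hsq' := fun f g hf hg => hsq n hn₁ f g hf hg
  push_cast
  rcases hroles with ⟨h1, h2⟩ | ⟨h1, h2⟩ | ⟨h1, h2⟩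
  · -- pair (S,T), third set U
    rw [h1] at hA; rw [h2] at hB
    exact youngSqueeze_pair_subthreshold hθ'' hκ hn1 hsq' S T U (youngSqueeze_pairTPP_of_tpp htpp hUn)
      hSU hTU f hf a b hA g hg a' b' hB
  · -- pair (T,U), third set S
    rw [h1] at hA; rw [h2] at hB
    have h := youngSqueeze_pair_subthreshold hθ'' hκ hn1 hsq' T U S
      (youngSqueeze_pairTPP_of_tpp htpp.rotate hSn) hTS hUS f hf a b hA g hg a' b' hB
    calc (S.card : ℝ) * T.card * U.card = (T.card : ℝ) * U.card * S.card := by ring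
      _ ≤ _ := h
  · -- pair (U,S) (capture of U first), third set T
    rw [h1] at hA; rw [h2] at hB
    have h := youngSqueeze_pair_subthreshold hθ'' hκ hn1 hsq' U S T
      (youngSqueeze_pairTPP_of_tpp htpp.rotate.rotate hTn) hUT hST g hg a' b' hB f hf a b hA
    calc (S.card : ℝ) * T.card * U.card = (U.card : ℝ) * S.card * T.card := by ring
      _ ≤ _ := h

end Summit.MatrixMultiplication.MatrixMultiplication.Theorems.GlobalBranch
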